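/-
Copyright: the b2b-balaban T⁴-continuum CRUX team, row NE7b OWNER lineage `t4-ne7b-p1` (gen 125). Project licence.
-/
import Summits.QuantumFields.BalabanUV.T4Continuum.Spine.NE7b.SupZdCoarseInverse
import Summits.QuantumFields.BalabanUV.T4Continuum.Spine.NE7b.SupZdKernelInverseCubeRate

/-!
# KERNEL ALGEBRA ON `ℤ^d`, VII: A SYMMETRIC DECAYING KERNEL WITH A FLOOR — ITS FINITE SECTIONS ARE UNIFORMLY INVERTIBLE AND THE SECTION
# INVERSES CONVERGE, EXPONENTIALLY IN THE MARGIN, TO ITS DECAYING INVERSE: `T` symmetric, `|T(b,c)| ≤ Ce^{−δ|b−c|₁}`, `γΣ_Sg² ≤ ⟨g, Tg⟩_S` on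
# finite supports ⟹ every section `T_S = (T(b,c))_{b,c ∈ S}` satisfies [B4] (5.6) with the SAME `(γ, C, δ)`, so ([B4] Sect. 5, tree-proved)
# `|T_S⁻¹(b,c)| ≤ c₁e^{−δ₁|b−c|₁}` uniformly in `S`; and if `N` is ANY decaying kernel with `TN = 1` then `(T_{Q_R})⁻¹(b,b′) → N(b,b′)` along the
# cubes with `|(T_{Q_R})⁻¹(b,b′) − N(b,b′)| ≤ c·(e^{−(ν′∕2)(R − |b|₁)} + e^{−(ν′∕2)(R − |b′|₁)})` — the `δ`-padded section inverse is a decaying LEFT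
# inverse of the `δ`-padded section on `ℤ^d`, to which (227)∕(229) apply against the right inverse `N`.  The finite-matrix approximation of
# the perturbed next-scale Hessian `N_K` ((234) supplies symmetry, floor and decay of `T_K`), and the `ℤ^d` half of the torus → `ℤ^d`
# identification for the `H + K` column (row NE7b, node U5c; (194)∕(227)∕(229)∕[B4] Sect. 5 BY NAME; [folklore])

Cell `pub-balaban`, sub-cell `t4`, spine estimate NE7b (`T4WeightBudget.RelWeightBound`; the cell's OWN estimate — NOT PRINTED in
[Bałaban 1983–89], NOT PROVED).  Crux-route work under `Spine/NE7b/` by the row OWNER (`t4-ne7b-p1` gen 125, file (236)) under FREEZE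
(0)'s crux-prover clause; NOTHING of Bałaban's is named as a Lean object, valued or asserted; no `T4Continuum/Support` leaf typed; no `def`,
no notation (sections are `Matrix.of fun b c : S => T b c`, the cubes and the padded kernels WRITTEN OUT); zero `sorry`; no road object
(pure kernel algebra).  Imports (BY NAME): the OWNER's (194) `…SupZdCoarseInverse` (`isPseudoDist_l1_section`, `sumBound_l1_section`,
`mem_cube_of_l1_le`, `cube_mono`; through it (193) `extendByZero_sum`, (191) `natAbs_sub_comm_sum`), (229)
`…SupZdKernelInverseCubeRate` (`inverse_ball_rate`; through it (227) `inverse_tendsto`), the Literature engine `B4Sect5Torus`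
(`Hyp56`, `sect5Uniform_holds`, `isUnit_of_hyp56` = [B4] Sect. 5 PROVED over finite index sets), Mathlib's `Matrix.mul_nonsing_inv`,
`Matrix.nonsing_inv_mul`, `tsum_eq_sum`.

WHY (located).  (194)∕(195)∕(205) built `M = T_∞⁻¹` FROM its sections; the `H + K` column's `N_K` ((218)∕(219)) came from a Neumann series,
and (234) has just given `T_K` (for symmetric `K`) the three properties [B4] Sect. 5 consumes: symmetry, a floor on finite supports, decaying
entries.  What the finite-matrix approximants `(T_{K,S})⁻¹` converge to must then be `N_K` — but rather than re-running (194)'s cube-limit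
construction and (195)'s Tannery identification, pad: `A_S = T` on `S × S`, `δ` elsewhere; `N_S = T_S⁻¹` on `S × S`, `δ` elsewhere.  `N_S` is a
decaying LEFT inverse of `A_S` on all of `ℤ^d` (a finite row computation), `A_S → T` entrywise along the cubes, all kernels bounded, and
`N` is a decaying RIGHT inverse of `T`: (227) `inverse_tendsto` gives the limit and (229) `inverse_ball_rate` (agreement on the `ℓ¹`-ball of
radius `R ⊆ Q_R`, `ε = 0`) the rate.  Stated for ANY `(T, N)`: the road instance is (234)'s `(T_K, N_K)` by name.

WHAT IS PROVED ([folklore]): §1 **`kernel_section_hyp56`** (symmetry + floor + decay ⟹ (5.6) for every section, same constants);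
§2 **`kernel_section_inverse`** (`∃ c₁ δ₁ > 0` from `(γ, C, δ, d)`: uniform decay of all section inverses and the two finite identities);
§3 `padded_left_inverse`, `padded_inverse_decay`, `padded_bound`, `padded_tendsto` (the padded kernels); §4 THE END
**`section_inverses_tendsto`** (`∃ c₁ δ₁ > 0`: for ALL symmetric `T` with floor `γ` and decay `(C, δ)`, ALL decaying right inverses `N`
(`C_N`, `ν`): uniform section-inverse decay, `(T_{Q_R})⁻¹(b,b′) → N(b,b′)`, and the explicit exponential rate in the margins); §5 toy.

HONEST (what this is NOT).  Kernel algebra; the torus side of the `H + K` identification (seam estimates for `T_K^{torus}` against `T_K∘wm`,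
[B4] (5.10) on the torus) is the sequel; nothing of the covariant propagators of [B4]–[B6]; nothing of Bałaban's asserted.  BY-NAME EFFECT ON
THE WALL: NONE.  NE7b NOT PRINTED ∕ NOT PROVED; spine PROVED 0∕9; rung (B)+1 — the programme's measures remain FINITE-torus statements; NOT the
mass gap, NOT Clay.  HONEST DEPENDENCY: continuum YM on T⁴ ⇐ BetaPertH ∧ nine spine estimates (0∕9 proved); BetaPertH ⇐ (D1) ∧ (D4) ∧
CAP+tail; G-an2-4 gates asym, D1 and NE2∕3∕4.
-/

set_option autoImplicit false

noncomputable section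

namespace Summit.QuantumFields.BalabanUV.T4Continuum.NE7b.SupZdKernelSections

open Real Filter Topology
open Literature.MathematicalPhysics.QuantumFieldTheory.Balaban1983to89
open B6QGQLower276 (X)
open B4Sect5Torus (IsPseudoDist SumBound Hyp56 sect5Uniform_holds isUnit_of_hyp56)
open SupZdCoarseForm (natAbs_sub_comm_sum)
open SupZdCoarseSections (extendByZero_sum)
open SupZdCoarseInverse (isPseudoDist_l1_section sumBound_l1_section mem_cube_of_l1_le cube_mono)
open SupZdKernelInverseLimit (inverse_tendsto)
open SupZdKernelInverseCubeRate (inverse_ball_rate)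

variable {d : ℕ}

/-! ## §1. Symmetry, floor and decay give [B4] (5.6) on every section -/

/-- **EVERY SECTION SATISFIES (5.6) WITH THE SAME CONSTANTS**: `T` symmetric, floor `γΣ_Sg² ≤ ⟨g, Tg⟩_S` on finite supports, `|T(b,c)| ≤
Ce^{−δ|b−c|₁}` ⟹ `Hyp56 (ℓ¹ on S) T_S γ C δ` for every finite `S ⊂ ℤ^d` (the floor on the zero extension, (193)). [folklore] -/
theorem kernel_section_hyp56 {γ C δ : ℝ} (T : X d → X d → ℝ) (hTs : ∀ b c, T b c = T c b)
    (hfloor : ∀ (S : Finset (X d)) (g : X d → ℝ), (∀ b, b ∉ S → g b = 0) →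
      γ * ∑ b ∈ S, g b ^ 2 ≤ ∑ b ∈ S, g b * ∑ c ∈ S, T b c * g c)
    (hT : ∀ b c, |T b c| ≤ C * exp (-(δ * ∑ i, (((b i - c i).natAbs : ℕ) : ℝ)))) (S : Finset (X d)) :
    Hyp56 (fun b b' : S => ∑ i, ((((b : X d) i - (b' : X d) i).natAbs : ℕ) : ℝ)) (Matrix.of fun b b' : S => T b b') γ C δ := by
  classical
  refine ⟨Matrix.IsSymm.ext fun b b' => ?_, fun v => ?_, fun b b' => ?_⟩
  · simp only [Matrix.of_apply]; exact hTs _ _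
  · have hzero : ∀ b, b ∉ S → (fun b => if h : b ∈ S then v ⟨b, h⟩ else (0 : ℝ)) b = 0 := fun b hb => by
      simp only [dif_neg hb]
    have h := hfloor S (fun b => if h : b ∈ S then v ⟨b, h⟩ else 0) hzero
    have hsq : ∑ b ∈ S, (if h : b ∈ S then v ⟨b, h⟩ else 0) ^ 2 = ∑ b : S, v b ^ 2 := extendByZero_sum S v (fun _ x => x ^ 2)
    have hform : ∑ b ∈ S, (if h : b ∈ S then v ⟨b, h⟩ else 0) * ∑ b' ∈ S, T b b' * (if h : b' ∈ S then v ⟨b', h⟩ else 0)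
        = ∑ b : S, v b * (Matrix.of fun b b' : S => T b b').mulVec v b := by
      rw [extendByZero_sum S v (fun b x => x * ∑ b' ∈ S, T b b' * (if h : b' ∈ S then v ⟨b', h⟩ else 0))]
      refine Finset.sum_congr rfl fun b _ => ?_
      simp only [Matrix.mulVec, dotProduct, Matrix.of_apply]
      rw [extendByZero_sum S v (fun b' x => T b b' * x)]
    rw [hsq, hform] at h
    exact h
  · simp only [Matrix.of_apply]; exact hT _ _

/-! ## §2. The section inverses decay uniformly -/

/-- **UNIFORM DECAY OF ALL SECTION INVERSES** ([B4] Sect. 5 (5.7) by name, `B4Sect5Torus.sect5Uniform_holds`): `∃ c₁ δ₁ > 0` from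
`(γ, C, δ, d)` such that for EVERY symmetric kernel with floor `γ` and decay `(C, δ)` and EVERY finite `S`: `|T_S⁻¹(b,c)| ≤ c₁e^{−δ₁|b−c|₁}`,
`T_ST_S⁻¹ = 1 = T_S⁻¹T_S` entrywise. [folklore] -/
theorem kernel_section_inverse {γ C δ : ℝ} (hγ : 0 < γ) (hC : 0 < C) (hδ : 0 < δ) :
    ∃ c₁ δ₁ : ℝ, 0 < c₁ ∧ 0 < δ₁ ∧ ∀ (T : X d → X d → ℝ), (∀ b c, T b c = T c b) →
      (∀ (S : Finset (X d)) (g : X d → ℝ), (∀ b, b ∉ S → g b = 0) →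
        γ * ∑ b ∈ S, g b ^ 2 ≤ ∑ b ∈ S, g b * ∑ c ∈ S, T b c * g c) →
      (∀ b c, |T b c| ≤ C * exp (-(δ * ∑ i, (((b i - c i).natAbs : ℕ) : ℝ)))) →
      ∀ S : Finset (X d),
        (∀ b b' : S, |(Matrix.of fun b b' : S => T b b')⁻¹ b b'|
          ≤ c₁ * exp (-(δ₁ * ∑ i, ((((b : X d) i - (b' : X d) i).natAbs : ℕ) : ℝ)))) ∧
        (∀ b b' : S, ∑ c : S, T b c * (Matrix.of fun b b' : S => T b b')⁻¹ c b' = if b = b' then 1 else 0) ∧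
        (∀ b b' : S, ∑ c : S, (Matrix.of fun b b' : S => T b b')⁻¹ b c * T c b' = if b = b' then 1 else 0) := by
  classical
  have hK : ∀ α : ℝ, 0 < α → 0 ≤ (2 * (1 - exp (-α))⁻¹) ^ d := fun α hα =>
    pow_nonneg (mul_nonneg zero_le_two (inv_nonneg.2 (sub_nonneg.2 (exp_le_one_iff.2 (by linarith))))) d
  obtain ⟨c₁, δ₁, hc₁, hδ₁, H5⟩ := sect5Uniform_holds (fun α => (2 * (1 - exp (-α))⁻¹) ^ d) hK γ C δ hγ hC hδ
  refine ⟨c₁, δ₁, hc₁, hδ₁, fun T hTs hfloor hT S => ?_⟩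
  have h56 := kernel_section_hyp56 T hTs hfloor hT S
  have h := H5 (S : Type) (fun b b' : S => ∑ i, ((((b : X d) i - (b' : X d) i).natAbs : ℕ) : ℝ))
    (isPseudoDist_l1_section S) (sumBound_l1_section S) _ h56 (S : Type) id Function.injective_id
  have hunit : IsUnit (Matrix.of fun b b' : S => T b b').det :=
    (Matrix.isUnit_iff_isUnit_det _).1 (isUnit_of_hyp56 hγ h56)
  refine ⟨fun b b' => ?_, fun b b' => ?_, fun b b' => ?_⟩
  · have h1 := h.1 b b'
    rw [Matrix.submatrix_id_id] at h1
    exact h1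
  · have h2 := congrFun (congrFun (Matrix.mul_nonsing_inv _ hunit) b) b'
    rw [Matrix.mul_apply, Matrix.one_apply] at h2
    simpa only [Matrix.of_apply] using h2
  · have h2 := congrFun (congrFun (Matrix.nonsing_inv_mul _ hunit) b) b'
    rw [Matrix.mul_apply, Matrix.one_apply] at h2
    simpa only [Matrix.of_apply] using h2

/-! ## §3. The padded kernels -/

section Padded

variable (T : X d → X d → ℝ) (S : Finset (X d))

/-- **THE PADDED SECTION INVERSE IS A LEFT INVERSE OF THE PADDED SECTION ON `ℤ^d`**: with `A_S = T` on `S × S` and `δ` elsewhere,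
`N_S = T_S⁻¹` on `S × S` and `δ` elsewhere, `Σ′_cN_S(b,c)A_S(c,b′) = δ_{bb′}` — a finite row computation from `T_S⁻¹T_S = 1`. [folklore] -/
theorem padded_left_inverse
    (hinv : ∀ b b' : S, ∑ c : S, (Matrix.of fun b b' : S => T b b')⁻¹ b c * T c b' = if b = b' then 1 else 0)
    (b b' : X d) :
    ∑' c : X d, (if h : b ∈ S ∧ c ∈ S then (Matrix.of fun b b' : S => T b b')⁻¹ ⟨b, h.1⟩ ⟨c, h.2⟩ else if b = c then 1 else 0)
      * (if c ∈ S ∧ b' ∈ S then T c b' else if c = b' then 1 else 0) = if b = b' then 1 else 0 := by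
  classical
  rw [tsum_eq_sum (s := insert b S) (fun c hc => ?_)]
  · by_cases hb : b ∈ S
    · rw [Finset.insert_eq_of_mem hb]
      by_cases hb' : b' ∈ S
      · -- both in `S`: the finite identity
        rw [← Finset.sum_coe_sort S]
        have e : ∀ c : S, (if h : b ∈ S ∧ (c : X d) ∈ S then (Matrix.of fun b b' : S => T b b')⁻¹ ⟨b, h.1⟩ ⟨c, h.2⟩
              else if b = c then 1 else 0) * (if (c : X d) ∈ S ∧ b' ∈ S then T c b' else if (c : X d) = b' then 1 else 0)
            = (Matrix.of fun b b' : S => T b b')⁻¹ ⟨b, hb⟩ c * T c b' := fun c => by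
          rw [dif_pos ⟨hb, c.2⟩, if_pos ⟨c.2, hb'⟩]
        rw [Finset.sum_congr rfl fun c _ => e c, hinv ⟨b, hb⟩ ⟨b', hb'⟩]
        simp only [Subtype.mk.injEq]
      · -- `b ∈ S`, `b′ ∉ S`: every term vanishes
        rw [if_neg (show ¬ b = b' from fun h => hb' (by rw [← h]; exact hb))]
        refine Finset.sum_eq_zero fun c hc => ?_
        rw [if_neg (show ¬ (c ∈ S ∧ b' ∈ S) from fun h => hb' h.2),
          if_neg (show ¬ c = b' from fun h => hb' (by rw [← h]; exact hc)), mul_zero]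
    · -- `b ∉ S`: the row of `N_S` is `δ_b`
      rw [Finset.sum_insert hb, dif_neg (show ¬ (b ∈ S ∧ b ∈ S) from fun h => hb h.1), if_pos rfl, one_mul,
        if_neg (show ¬ (b ∈ S ∧ b' ∈ S) from fun h => hb h.1)]
      have hrest : ∑ c ∈ S, (if h : b ∈ S ∧ c ∈ S then (Matrix.of fun b b' : S => T b b')⁻¹ ⟨b, h.1⟩ ⟨c, h.2⟩
          else if b = c then 1 else 0) * (if c ∈ S ∧ b' ∈ S then T c b' else if c = b' then 1 else 0) = 0 :=
        Finset.sum_eq_zero fun c hc => by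
          rw [dif_neg (show ¬ (b ∈ S ∧ c ∈ S) from fun h => hb h.1),
            if_neg (show ¬ b = c from fun h => hb (by rw [h]; exact hc)), zero_mul]
      rw [hrest, add_zero]
  · -- off `insert b S` the row of `N_S` vanishes
    have hcb : c ≠ b := fun h => hc (h ▸ Finset.mem_insert_self b S)
    have hcS : c ∉ S := fun h => hc (Finset.mem_insert_of_mem h)
    rw [dif_neg (show ¬ (b ∈ S ∧ c ∈ S) from fun h => hcS h.2), if_neg (show ¬ b = c from fun h => hcb h.symm), zero_mul]

/-- The padded section inverse decays like the section inverse (the `δ` part sits on the diagonal). [folklore] -/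
theorem padded_inverse_decay {c₁ δ₁ : ℝ}
    (hdec : ∀ b b' : S, |(Matrix.of fun b b' : S => T b b')⁻¹ b b'|
      ≤ c₁ * exp (-(δ₁ * ∑ i, ((((b : X d) i - (b' : X d) i).natAbs : ℕ) : ℝ)))) (b c : X d) :
    |(if h : b ∈ S ∧ c ∈ S then (Matrix.of fun b b' : S => T b b')⁻¹ ⟨b, h.1⟩ ⟨c, h.2⟩ else if b = c then 1 else 0)|
      ≤ max c₁ 1 * exp (-(δ₁ * ∑ i, (((b i - c i).natAbs : ℕ) : ℝ))) := by
  classical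
  by_cases h : b ∈ S ∧ c ∈ S
  · rw [dif_pos h]
    exact (hdec ⟨b, h.1⟩ ⟨c, h.2⟩).trans (mul_le_mul_of_nonneg_right (le_max_left _ _) (exp_pos _).le)
  · rw [dif_neg h]
    by_cases hbc : b = c
    · subst hbc
      simp only [if_true, sub_self, Int.natAbs_zero, Nat.cast_zero, Finset.sum_const_zero, mul_zero, neg_zero, exp_zero,
        mul_one, abs_one]
      exact le_max_right _ _
    · rw [if_neg hbc, abs_zero]; positivity

/-- The padded section is a bounded kernel. [folklore] -/
theorem padded_bound {C δ : ℝ} (hδ : 0 ≤ δ) (hT : ∀ b c, |T b c| ≤ C * exp (-(δ * ∑ i, (((b i - c i).natAbs : ℕ) : ℝ))))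
    (c b' : X d) : |(if c ∈ S ∧ b' ∈ S then T c b' else if c = b' then 1 else 0)| ≤ max C 1 := by
  classical
  have hC : 0 ≤ C := by
    have h := (abs_nonneg _).trans (hT c c)
    exact le_of_mul_le_mul_right (by rw [zero_mul]; exact h) (exp_pos _)
  by_cases h : c ∈ S ∧ b' ∈ S
  · rw [if_pos h]
    exact ((hT c b').trans (mul_le_of_le_one_right hC (exp_le_one_iff.2 (by rw [neg_nonpos]; positivity)))).trans
      (le_max_left _ _)
  · rw [if_neg h]
    by_cases hcb : c = b'
    · rw [if_pos hcb, abs_one]; exact le_max_right _ _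
    · rw [if_neg hcb, abs_zero]; positivity

end Padded

/-- The padded cube sections converge entrywise to the kernel (they are eventually equal to it). [folklore] -/
theorem padded_tendsto (T : X d → X d → ℝ) (c c' : X d) :
    Tendsto (fun R : ℕ => if c ∈ (Fintype.piFinset fun _ : Fin d => Finset.Icc (-(R : ℤ)) R) ∧
        c' ∈ (Fintype.piFinset fun _ : Fin d => Finset.Icc (-(R : ℤ)) R) then T c c' else if c = c' then 1 else 0)
      atTop (𝓝 (T c c')) := by
  classical
  refine tendsto_const_nhds.congr' (Filter.eventually_atTop.2 ⟨max (∑ j, (c j).natAbs) (∑ j, (c' j).natAbs), fun R hR => ?_⟩)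
  have hm : c ∈ (Fintype.piFinset fun _ : Fin d => Finset.Icc (-(R : ℤ)) R) ∧
      c' ∈ (Fintype.piFinset fun _ : Fin d => Finset.Icc (-(R : ℤ)) R) :=
    ⟨cube_mono hR (mem_cube_of_l1_le _ c (le_max_left _ _)), cube_mono hR (mem_cube_of_l1_le _ c' (le_max_right _ _))⟩
  dsimp only
  rw [if_pos hm]

/-! ## §4. THE END: the section inverses converge to the decaying inverse, exponentially in the margin -/

/-- **HEADLINE — SECTION INVERSES OF A SYMMETRIC DECAYING KERNEL WITH A FLOOR CONVERGE TO ITS DECAYING INVERSE.**  `∃ c₁ δ₁ > 0` from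
`(γ, C, δ, d)` such that for EVERY symmetric kernel `T` on `ℤ^d` with the floor `γΣ_Sg² ≤ ⟨g, Tg⟩_S` on finite supports and `|T(b,c)| ≤
Ce^{−δ|b−c|₁}`, and EVERY kernel `N` with `|N(b,c)| ≤ C_Ne^{−ν|b−c|₁}` and `TN = 1` (rows): (i) all section inverses decay, `|T_S⁻¹(b,c)| ≤
c₁e^{−δ₁|b−c|₁}`, with `T_ST_S⁻¹ = 1 = T_S⁻¹T_S`; (ii) `(T_{Q_R})⁻¹(b,b′) → N(b,b′)` along the cubes `Q_R = [−R,R]^d`; (iii) for `b, b′ ∈ Q_R`: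
`|(T_{Q_R})⁻¹(b,b′) − N(b,b′)| ≤ C′²K_{ν′}·2·max(C,1)·K_{ν′∕2}·(e^{−(ν′∕2)(R − |b|₁)} + e^{−(ν′∕2)(R − |b′|₁)})`, `ν′ = min(δ₁, ν)`, `C′ = max(max(c₁,1), C_N)`
— the padded section inverse is a decaying left inverse of the padded section ((§3)), (227) for the limit, (229) for the rate.  In
particular `N` is the ONLY candidate limit: the decaying right inverse of such a `T` is unique. [folklore] -/
theorem section_inverses_tendsto {γ C δ : ℝ} (hγ : 0 < γ) (hC : 0 < C) (hδ : 0 < δ) :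
    ∃ c₁ δ₁ : ℝ, 0 < c₁ ∧ 0 < δ₁ ∧ ∀ (T N : X d → X d → ℝ) (CN ν : ℝ), 0 ≤ CN → 0 < ν →
      (∀ b c, T b c = T c b) →
      (∀ (S : Finset (X d)) (g : X d → ℝ), (∀ b, b ∉ S → g b = 0) →
        γ * ∑ b ∈ S, g b ^ 2 ≤ ∑ b ∈ S, g b * ∑ c ∈ S, T b c * g c) →
      (∀ b c, |T b c| ≤ C * exp (-(δ * ∑ i, (((b i - c i).natAbs : ℕ) : ℝ)))) →
      (∀ b c, |N b c| ≤ CN * exp (-(ν * ∑ i, (((b i - c i).natAbs : ℕ) : ℝ)))) →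
      (∀ b c, ∑' b' : X d, T b b' * N b' c = if b = c then 1 else 0) →
      (∀ S : Finset (X d),
        (∀ b b' : S, |(Matrix.of fun b b' : S => T b b')⁻¹ b b'|
          ≤ c₁ * exp (-(δ₁ * ∑ i, ((((b : X d) i - (b' : X d) i).natAbs : ℕ) : ℝ)))) ∧
        (∀ b b' : S, ∑ c : S, T b c * (Matrix.of fun b b' : S => T b b')⁻¹ c b' = if b = b' then 1 else 0) ∧
        (∀ b b' : S, ∑ c : S, (Matrix.of fun b b' : S => T b b')⁻¹ b c * T c b' = if b = b' then 1 else 0)) ∧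
      (∀ b b' : X d, Tendsto (fun R : ℕ =>
        if h : b ∈ (Fintype.piFinset fun _ : Fin d => Finset.Icc (-(R : ℤ)) R) ∧
            b' ∈ (Fintype.piFinset fun _ : Fin d => Finset.Icc (-(R : ℤ)) R)
          then (Matrix.of fun c c' : ↥(Fintype.piFinset fun _ : Fin d => Finset.Icc (-(R : ℤ)) R) => T c c')⁻¹ ⟨b, h.1⟩ ⟨b', h.2⟩
          else 0) atTop (𝓝 (N b b'))) ∧
      (∀ (R : ℕ) (b b' : X d) (hb : b ∈ (Fintype.piFinset fun _ : Fin d => Finset.Icc (-(R : ℤ)) R))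
        (hb' : b' ∈ (Fintype.piFinset fun _ : Fin d => Finset.Icc (-(R : ℤ)) R)),
        |(Matrix.of fun c c' : ↥(Fintype.piFinset fun _ : Fin d => Finset.Icc (-(R : ℤ)) R) => T c c')⁻¹ ⟨b, hb⟩ ⟨b', hb'⟩ - N b b'|
          ≤ (max (max c₁ 1) CN) ^ 2 * (2 * (1 - exp (-(min δ₁ ν)))⁻¹) ^ d
            * (0 * (2 * (1 - exp (-(min δ₁ ν)))⁻¹) ^ d + 2 * max C 1 * (2 * (1 - exp (-(min δ₁ ν / 2)))⁻¹) ^ d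
              * (exp (-(min δ₁ ν / 2 * (R - ∑ i, (((b i - (0 : X d) i).natAbs : ℕ) : ℝ))))
                + exp (-(min δ₁ ν / 2 * (R - ∑ i, (((b' i - (0 : X d) i).natAbs : ℕ) : ℝ))))))) := by
  classical
  obtain ⟨c₁, δ₁, hc₁, hδ₁, H2⟩ := kernel_section_inverse (d := d) hγ hC hδ
  refine ⟨c₁, δ₁, hc₁, hδ₁, fun T N CN ν hCN hν hTs hfloor hT hN hTN => ?_⟩
  have hsec := H2 T hTs hfloor hT
  refine ⟨hsec, ?_⟩
  -- the padded kernels along the cubes, with the common decay rate `ν′ = min δ₁ ν`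
  obtain ⟨AP, hAP⟩ : ∃ AP : ℕ → X d → X d → ℝ, ∀ R c b', AP R c b' =
      if c ∈ (Fintype.piFinset fun _ : Fin d => Finset.Icc (-(R : ℤ)) R) ∧
          b' ∈ (Fintype.piFinset fun _ : Fin d => Finset.Icc (-(R : ℤ)) R) then T c b' else if c = b' then 1 else 0 :=
    ⟨_, fun _ _ _ => rfl⟩
  obtain ⟨NP, hNP⟩ : ∃ NP : ℕ → X d → X d → ℝ, ∀ R b c, NP R b c =
      if h : b ∈ (Fintype.piFinset fun _ : Fin d => Finset.Icc (-(R : ℤ)) R) ∧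
          c ∈ (Fintype.piFinset fun _ : Fin d => Finset.Icc (-(R : ℤ)) R)
        then (Matrix.of fun c c' : ↥(Fintype.piFinset fun _ : Fin d => Finset.Icc (-(R : ℤ)) R) => T c c')⁻¹ ⟨b, h.1⟩ ⟨c, h.2⟩
        else if b = c then 1 else 0 := ⟨_, fun _ _ _ => rfl⟩
  have hν' : 0 < min δ₁ ν := lt_min hδ₁ hν
  have hrate : ∀ (r x : ℝ), min δ₁ ν ≤ r → 0 ≤ x → exp (-(r * x)) ≤ exp (-(min δ₁ ν * x)) := fun r x hr hx =>
    exp_le_exp.2 (neg_le_neg (mul_le_mul_of_nonneg_right hr hx))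
  have hCA : 0 ≤ max C 1 := le_trans zero_le_one (le_max_right _ _)
  have hCn : 0 ≤ max (max c₁ 1) CN := le_trans (le_trans zero_le_one (le_max_right _ _)) (le_max_left _ _)
  have hAPb : ∀ R c b', |AP R c b'| ≤ max C 1 := fun R c b' => by rw [hAP]; exact padded_bound T _ hδ.le hT c b'
  have hTb : ∀ c b', |T c b'| ≤ max C 1 := fun c b' =>
    ((hT c b').trans (mul_le_of_le_one_right hC.le (exp_le_one_iff.2 (by rw [neg_nonpos]; positivity)))).trans (le_max_left _ _)
  have hNPd : ∀ R b c, |NP R b c| ≤ max (max c₁ 1) CN * exp (-(min δ₁ ν * ∑ i, (((b i - c i).natAbs : ℕ) : ℝ))) := by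
    intro R b c
    rw [hNP]
    refine (padded_inverse_decay T _ (hsec _).1 b c).trans ?_
    exact mul_le_mul (le_max_left _ _) (hrate δ₁ _ (min_le_left _ _) (by positivity)) (exp_pos _).le hCn
  have hNd : ∀ b c, |N b c| ≤ max (max c₁ 1) CN * exp (-(min δ₁ ν * ∑ i, (((b i - c i).natAbs : ℕ) : ℝ))) := fun b c =>
    (hN b c).trans (mul_le_mul (le_max_right _ _) (hrate ν _ (min_le_right _ _) (by positivity)) (exp_pos _).le hCn)
  have hleft : ∀ R b b', ∑' c : X d, NP R b c * AP R c b' = if b = b' then 1 else 0 := by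
    intro R b b'
    simp only [hNP, hAP]
    exact padded_left_inverse T _ (hsec _).2.2 b b'
  have hlimA : ∀ c c', Tendsto (fun R => AP R c c') atTop (𝓝 (T c c')) := fun c c' => by
    simp only [hAP]; exact padded_tendsto T c c'
  refine ⟨fun b b' => ?_, fun R b b' hb hb' => ?_⟩
  · -- (ii) the limit, by (227)
    have h := inverse_tendsto hCA hCn hν' AP NP T N hAPb hTb hNPd hNd hleft hTN hlimA b b'
    refine h.congr' (Filter.eventually_atTop.2 ⟨max (∑ j, (b j).natAbs) (∑ j, (b' j).natAbs), fun R hR => ?_⟩)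
    have hm : b ∈ (Fintype.piFinset fun _ : Fin d => Finset.Icc (-(R : ℤ)) R) ∧
        b' ∈ (Fintype.piFinset fun _ : Fin d => Finset.Icc (-(R : ℤ)) R) :=
      ⟨cube_mono hR (mem_cube_of_l1_le _ b (le_max_left _ _)), cube_mono hR (mem_cube_of_l1_le _ b' (le_max_right _ _))⟩
    dsimp only
    rw [hNP, dif_pos hm, dif_pos hm]
  · -- (iii) the rate, by (229) with `ε = 0` on the `ℓ¹`-ball of radius `R ⊆ Q_R`
    have hagree : ∀ c c' : X d, ∑ i, (((c i - (0 : X d) i).natAbs : ℕ) : ℝ) ≤ R →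
        ∑ i, (((c' i - (0 : X d) i).natAbs : ℕ) : ℝ) ≤ R → |T c c' - AP R c c'| ≤ 0 := by
      intro c c' hc hc'
      have hcQ : c ∈ (Fintype.piFinset fun _ : Fin d => Finset.Icc (-(R : ℤ)) R) := by
        refine mem_cube_of_l1_le _ c ?_
        have h : ((∑ j, (c j).natAbs : ℕ) : ℝ) ≤ R := by
          rw [Nat.cast_sum]; simpa only [Pi.zero_apply, sub_zero] using hc
        exact_mod_cast h
      have hc'Q : c' ∈ (Fintype.piFinset fun _ : Fin d => Finset.Icc (-(R : ℤ)) R) := by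
        refine mem_cube_of_l1_le _ c' ?_
        have h : ((∑ j, (c' j).natAbs : ℕ) : ℝ) ≤ R := by
          rw [Nat.cast_sum]; simpa only [Pi.zero_apply, sub_zero] using hc'
        exact_mod_cast h
      rw [hAP, if_pos ⟨hcQ, hc'Q⟩, sub_self, abs_zero]
    have h := inverse_ball_rate hCA hCn hν' le_rfl (AP R) T (NP R) N (hAPb R) hTb (hNPd R) hNd (hleft R) hTN hagree b b'
    rw [hNP, dif_pos ⟨hb, hb'⟩] at h
    exact h

/-! ## §5. Toy -/

/-- Toy (`d = 1`): for the identity kernel (symmetric, floor `1`, decay `(1,1)`, its own inverse) the section letters exist. -/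
example : ∃ c₁ δ₁ : ℝ, 0 < c₁ ∧ 0 < δ₁ :=
  let ⟨c₁, δ₁, h1, h2, _⟩ := section_inverses_tendsto (d := 1) (γ := 1) (C := 1) (δ := 1) one_pos one_pos one_pos
  ⟨c₁, δ₁, h1, h2⟩

end Summit.QuantumFields.BalabanUV.T4Continuum.NE7b.SupZdKernelSections
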